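import Literature.Analysis.FunctionSpaces.WightmanGNSSpectral
import HarnessLib

/-!
# Wightman reconstruction: discharge of the spectral input `GNSSpectralInput`

Streater–Wightman (1964), §3-4, proof of Thm. 3-7, p. 110: "There remains only one property of
`U(a, Λ)` to be verified, namely, that its energy momentum spectrum lies in or on the future light
cone. This is an immediate consequence of (3-44)."

`WightmanGNSReconstruction.lean` assembles the GNS data `gnsData 𝒲 h𝒲` of a family `𝒲` of
tempered distributions with the properties (a)–(f) (`IsWightmanFamily`) and proves the Wightman
axioms W0–W4 for them **given** the spectral input
`GNSSpectralInput 𝒲 h𝒲 := (translRep 𝒲 h𝒲).HasFourierSpectrumIn (closedForwardCone d)`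
(`gnsData_isWightmanQFT`). The derivation of that input from the spectral condition (b) is carried
out in `WightmanGNSSpectral.lean` (basis matrix coefficients
`a ↦ ⟪[δ_l], U(a)[δ_{l'}]⟫ = 𝒲_{n+m}((⊗ l†) ⊗ τ_a (⊗ l'))`, the Schwartz exchange theorem on the
Fourier side, the support of the resulting test function against the spectral set, then density and
separate continuity), where it is stated in the universally quantified form
`GNS_spectral_condition_holds : ∀ d κ 𝒲 h𝒲, GNSSpectralInput 𝒲 h𝒲`.

This file only specialises that theorem to the given family — the statement file
`WightmanGNSReconstruction.lean` cannot import its own proof file — and records the resulting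
unconditional form of `gnsData_isWightmanQFT`.

## Main statements (all proved)

* `WightmanFamily.GNSSpace.GNSSpectralInput_holds : GNSSpectralInput 𝒲 h𝒲` — the spectral input
  discharged for every Wightman family `𝒲`.
* `WightmanFamily.GNSSpace.isWightmanQFT_gnsData` — for `d ≥ 1` the reconstructed data
  `gnsData 𝒲 h𝒲` satisfy W0–W4 unconditionally (Streater–Wightman Thm. 3-7, existence part, for
  the canonical GNS witness).

No new definitions, no new named facts.

## References

* R. F. Streater, A. S. Wightman, *PCT, Spin and Statistics, and All That*, Benjamin (1964),
  §3-4, Thm. 3-7 and its proof, p. 110 (the spectral step, from (3-44)). [StreaterWightman1964]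
-/

namespace Literature.Analysis.FunctionSpaces

namespace WightmanFamily.GNSSpace

open Literature.MathematicalPhysics.QuantumLattice

variable {d : ℕ} {κ : Type} (𝒲 : WightmanFamily d κ) (h𝒲 : IsWightmanFamily 𝒲)

/-- **The spectral input discharged** (Streater–Wightman (1964), §3-4, proof of Thm. 3-7, p. 110,
"an immediate consequence of (3-44)"): for every family `𝒲` of tempered distributions with the
properties (a)–(f), the strongly continuous unitary translation group `translRep 𝒲 h𝒲` of the GNS
Hilbert space has Fourier spectrum in the closed forward cone `V̄₊`. This is
`GNS_spectral_condition_holds` (`WightmanGNSSpectral.lean`, proved from the spectral condition (b)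
via the Schwartz exchange theorem and density) specialised to `𝒲`. [cite: StreaterWightman1964, §3-4, proof of Thm. 3-7, p. 110 (from (3-44))] -/
theorem GNSSpectralInput_holds : GNSSpectralInput 𝒲 h𝒲 :=
  GNS_spectral_condition_holds d κ 𝒲 h𝒲

/-- **The reconstructed data satisfy the Wightman axioms W0–W4, unconditionally** (`d ≥ 1`;
Streater–Wightman (1964), §3-4, Thm. 3-7, existence part, for the canonical GNS witness
`gnsData 𝒲 h𝒲`): `gnsData_isWightmanQFT` fed with `GNSSpectralInput_holds`. [cite: StreaterWightman1964, §3-4 Thm. 3-7] -/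
theorem isWightmanQFT_gnsData [NeZero d] : IsWightmanQFT (gnsData 𝒲 h𝒲) :=
  gnsData_isWightmanQFT (GNSSpectralInput_holds 𝒲 h𝒲)

end WightmanFamily.GNSSpace

end Literature.Analysis.FunctionSpaces
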